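import Literature.MathematicalPhysics.QuantumFieldTheory.Balaban1983to89.T3ContinuumYM3Torus
import Literature.MathematicalPhysics.QuantumFieldTheory.Balaban1983to89.B10Eq39CollarVolume

/-!
# Route `PoincareLipschitz` (planner ym-r3-idea-2 g7, LINE 15), glue `TwoSidedOfConcentration` (stmt-QuantumFields-23535) —
# helper 3: CORNERS IN THE FINEST LATTICE, the LOCAL PLAQUETTE COUNT, and the FINEST-BAD-LEVEL COVERING

The cruxes `BlockLipschitzL` and the glue's local good sets `G(a,j)` measure proximity of a level-`i` plaquette `q` to a level-`j`
plaquette `a` (`i < j`) of the `K`-th approximation through the `ℓ¹` torus distance of their CORNERS READ IN THE FINEST LATTICE,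
`x ↦ (x_k·L^i)_k ∈ T^{(0)}`: `near(q; a) :⇔ tdist(corner_i q, corner_j a) + 64·L^i ≤ 64·L^j`.  This file proves:

* §1 the finest-lattice reading scales distances exactly: `tdist(corner_i x, corner_i y) = L^i · tdist_i(x, y)` (`2L^{m+K} = 2L^{m+K−i}·L^i`
  sites per direction; `(x·L^i mod N·L^i) = (x mod N)·L^i`);
* §2 the corner of a level-`j` plaquette is the finest reading of a level-`i` site (`i ≤ j ≤ K`), so the level-`i` plaquettes near `a`
  have their sources in an `ℓ¹` ball of radius `64·L^{j−i}` of `T^{(i)}`: there are at most `9·(128·L^{j−i} + 1)³ ≤ 9·129³·L^{3(j−i)}` of them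
  (`B10Eq39CollarVolume.card_ball_le`), a count INDEPENDENT of the volume and of `K`;
* §3 the finest-bad-level covering: a configuration outside `G(a,j)` has a FINEST level `i < j` carrying a large plaquette `q` near `a`, and
  then lies in `G(q,i)` (nearness is transitive along `i' < i < j` by the triangle inequality for `tdist`), so
  `G(a,j)ᶜ ⊆ ⋃_{i<j} ⋃_{q near a} ({θ_i ≤ f_q} ∩ G(q,i))` — the recursion behind the height induction of the glue.

Width seat ym-line-sfw-p2-w3 g30 (cell ym-idea-1, R3 family; free hands), `--supports stmt-QuantumFields-23535`.  Lattice bookkeeping only; no crux,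
rung (R3 is a RECORD rung) or summit is proved; the Yang–Mills mass gap is NOT proved.
-/

set_option autoImplicit false

namespace Summit.QuantumFields.YangMills.Theorems.PoincareLipschitz.TwoSidedOfConcentration

open scoped BigOperators
open Literature.MathematicalPhysics.QuantumFieldTheory.Balaban1983to89
open Literature.MathematicalPhysics.QuantumFieldTheory.Balaban1983to89.T3ContinuumYM3Torus
open Literature.MathematicalPhysics.QuantumFieldTheory.Balaban1983to89.B3Taylor310LocalRemainder (tdist_triangle tdist_comm)
open Literature.MathematicalPhysics.QuantumFieldTheory.Balaban1983to89.B10Eq39CollarVolume (ball mem_ball card_ball_le)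

/-! ## §1 Scaling residues and torus distances from `ℤ/N` to `ℤ/(N·M)` -/

/-- `(x·M) − (y·M)` read modulo `N·M` has least residue `((x − y) mod N)·M`. [folklore] -/
theorem val_sub_scale {n M m : ℕ} [NeZero n] (hm : m = n * M) (hM : 0 < M) (x y : ZMod n) :
    ((((x.val * M : ℕ)) : ZMod m) - (((y.val * M : ℕ)) : ZMod m)).val = (x - y).val * M := by
  subst hm
  have hkey : ((((x - y).val * M : ℕ)) : ZMod (n * M)) = (((x.val * M : ℕ)) : ZMod (n * M)) - (((y.val * M : ℕ)) : ZMod (n * M)) := by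
    rw [eq_sub_iff_add_eq, ← Nat.cast_add, ZMod.natCast_eq_natCast_iff', ← add_mul, Nat.mul_mod_mul_right,
      Nat.mul_mod_mul_right]
    congr 1
    have h : ((((x - y).val + y.val : ℕ)) : ZMod n) = (((x.val : ℕ)) : ZMod n) := by
      push_cast
      rw [ZMod.natCast_zmod_val, ZMod.natCast_zmod_val, ZMod.natCast_zmod_val, sub_add_cancel]
    exact (ZMod.natCast_eq_natCast_iff' _ _ _).mp h
  rw [← hkey, ZMod.val_natCast]
  exact Nat.mod_eq_of_lt (Nat.mul_lt_mul_of_pos_right (ZMod.val_lt _) hM)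

/-- `min` commutes with multiplication by a natural number. [folklore] -/
theorem min_mul_right_nat (a b M : ℕ) : min (a * M) (b * M) = min a b * M := by
  rcases le_total a b with h | h
  · rw [min_eq_left h, min_eq_left (Nat.mul_le_mul_right M h)]
  · rw [min_eq_right h, min_eq_right (Nat.mul_le_mul_right M h)]

/-- **Finest-lattice readings scale the torus distance**: for sites `x, y` of `T^{(i)}` of the `K`-th approximation (`i ≤ K`),
`tdist((x_k L^i)_k, (y_k L^i)_k) = L^i · tdist(x, y)` in `T^{(0)}`. [cite: Balaban1985UV3, (1)-(3) p.256] -/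
theorem tdist_fine_eq (F : T3Family) {K i : ℕ} (hi : i ≤ K) (x y : Site (F.P K) i) :
    Site.tdist (fun k => ((((x k).val * F.L ^ i : ℕ)) : ZMod ((F.P K).sitesPerDir 0)))
        (fun k => ((((y k).val * F.L ^ i : ℕ)) : ZMod ((F.P K).sitesPerDir 0))) = F.L ^ i * Site.tdist x y := by
  have hm : (F.P K).sitesPerDir 0 = (F.P K).sitesPerDir i * F.L ^ i := by
    simp only [Params.sitesPerDir]
    show 2 * F.L ^ (F.m + K - 0) = 2 * F.L ^ (F.m + K - i) * F.L ^ i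
    rw [Nat.sub_zero, mul_assoc, ← pow_add, Nat.sub_add_cancel (by omega)]
  have hL : 0 < F.L ^ i := pow_pos (lt_trans zero_lt_one F.hL.2) i
  unfold Site.tdist
  rw [Finset.mul_sum]
  refine Finset.sum_congr rfl fun k _ => ?_
  rw [val_sub_scale hm hL, val_sub_scale hm hL, min_mul_right_nat, mul_comm]

/-! ## §2 Corners of coarse plaquettes and the local count -/

/-- **The corner of a level-`j` plaquette is the finest reading of a level-`i` site** (`i ≤ j ≤ K`): with
`s_k = (a.src)_k·L^{j−i}` (no wrap-around: `(a.src)_k < 2L^{m+K−j}`), `(s_k·L^i)_k = ((a.src)_k·L^j)_k`. [cite: Balaban1985UV3, (1)-(3) p.256] -/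
theorem corner_eq_fine_of_le (F : T3Family) {K i j : ℕ} (hij : i ≤ j) (hjK : j ≤ K) (a : Plaq (F.P K) j) :
    ∃ s : Site (F.P K) i, (fun k => ((((s k).val * F.L ^ i : ℕ)) : ZMod ((F.P K).sitesPerDir 0))) =
      (fun k => ((((a.src k).val * F.L ^ j : ℕ)) : ZMod ((F.P K).sitesPerDir 0))) := by
  refine ⟨fun k => ((((a.src k).val * F.L ^ (j - i) : ℕ)) : ZMod ((F.P K).sitesPerDir i)), funext fun k => ?_⟩
  have hlt : (a.src k).val * F.L ^ (j - i) < (F.P K).sitesPerDir i := by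
    have hv : (a.src k).val < (F.P K).sitesPerDir j := ZMod.val_lt _
    simp only [Params.sitesPerDir] at hv ⊢
    have h1 : (a.src k).val * F.L ^ (j - i) < 2 * F.L ^ (F.m + K - j) * F.L ^ (j - i) :=
      Nat.mul_lt_mul_of_pos_right hv (pow_pos (lt_trans zero_lt_one F.hL.2) _)
    have h2 : 2 * F.L ^ (F.m + K - j) * F.L ^ (j - i) = 2 * F.L ^ (F.m + K - i) := by
      rw [mul_assoc, ← pow_add]
      congr 2
      show F.m + K - j + (j - i) = F.m + K - i
      omega
    show (a.src k).val * F.L ^ (j - i) < 2 * F.L ^ ((F.P K).m + (F.P K).K - i)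
    have hm : (F.P K).m = F.m := rfl
    have hK : (F.P K).K = K := rfl
    rw [hm, hK, ← h2]
    exact h1
  simp only [ZMod.val_natCast, Nat.mod_eq_of_lt hlt]
  congr 1
  rw [mul_assoc, ← pow_add, Nat.sub_add_cancel hij]

/-- **THE LOCAL COUNT**: the level-`i` plaquettes `q` of the `K`-th approximation whose finest-lattice corner is within `64·L^j − 64·L^i` of
the corner of a level-`j` plaquette `a` (`i ≤ j ≤ K`) number at most `9·(128·L^{j−i} + 1)³` — their sources lie in the `ℓ¹` ball of radius
`64·L^{j−i}` about a level-`i` site, three plane labels squared. Volume- and `K`-independent. [cite: Balaban1985UV3, p.258] -/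
theorem card_near_le (F : T3Family) {K i j : ℕ} (hij : i ≤ j) (hjK : j ≤ K) (a : Plaq (F.P K) j) :
    (Finset.univ.filter fun q : Plaq (F.P K) i =>
        Site.tdist (fun k => ((((q.src k).val * F.L ^ i : ℕ)) : ZMod ((F.P K).sitesPerDir 0)))
            (fun k => ((((a.src k).val * F.L ^ j : ℕ)) : ZMod ((F.P K).sitesPerDir 0))) + 64 * F.L ^ i ≤ 64 * F.L ^ j).card ≤
      9 * (2 * (64 * F.L ^ (j - i)) + 1) ^ 3 := by
  classical
  obtain ⟨s, hs⟩ := corner_eq_fine_of_le F hij hjK a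
  have hL : 0 < F.L ^ i := pow_pos (lt_trans zero_lt_one F.hL.2) i
  have hLj : F.L ^ j = F.L ^ (j - i) * F.L ^ i := by rw [← pow_add, Nat.sub_add_cancel hij]
  -- the near plaquettes have their source in the ball of radius `64 L^{j-i}` about `s`
  have hsub : (Finset.univ.filter fun q : Plaq (F.P K) i =>
        Site.tdist (fun k => ((((q.src k).val * F.L ^ i : ℕ)) : ZMod ((F.P K).sitesPerDir 0)))
            (fun k => ((((a.src k).val * F.L ^ j : ℕ)) : ZMod ((F.P K).sitesPerDir 0))) + 64 * F.L ^ i ≤ 64 * F.L ^ j) ⊆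
      Finset.univ.filter fun q : Plaq (F.P K) i => Site.tdist s q.src ≤ 64 * F.L ^ (j - i) := by
    intro q hq
    simp only [Finset.mem_filter, Finset.mem_univ, true_and] at hq ⊢
    rw [← hs, tdist_fine_eq F (hij.trans hjK), tdist_comm] at hq
    have h1 : F.L ^ i * Site.tdist s q.src ≤ 64 * F.L ^ (j - i) * F.L ^ i := by rw [mul_assoc, ← hLj]; omega
    rw [mul_comm] at h1
    exact Nat.le_of_mul_le_mul_right h1 hL
  -- inject `q ↦ (q.src, q.μ, q.ν)` into `ball × planes`
  let f : Plaq (F.P K) i → Site (F.P K) i × (Fin (F.P K).d × Fin (F.P K).d) := fun q => (q.src, (q.μ, q.ν))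
  have hmaps : ∀ q ∈ (Finset.univ.filter fun q : Plaq (F.P K) i => Site.tdist s q.src ≤ 64 * F.L ^ (j - i)),
      f q ∈ ball s (64 * F.L ^ (j - i)) ×ˢ (Finset.univ : Finset (Fin (F.P K).d × Fin (F.P K).d)) := by
    intro q hq
    simp only [Finset.mem_filter, Finset.mem_univ, true_and] at hq
    exact Finset.mem_product.mpr ⟨mem_ball.mpr hq, Finset.mem_univ _⟩
  have hinj : Set.InjOn f ↑(Finset.univ.filter fun q : Plaq (F.P K) i => Site.tdist s q.src ≤ 64 * F.L ^ (j - i)) := by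
    intro q _ q' _ h
    obtain ⟨x, μ, ν, hμν⟩ := q
    obtain ⟨x', μ', ν', hμν'⟩ := q'
    simp only [f, Prod.mk.injEq] at h
    obtain ⟨rfl, rfl, rfl⟩ := h
    rfl
  calc (Finset.univ.filter fun q : Plaq (F.P K) i =>
        Site.tdist (fun k => ((((q.src k).val * F.L ^ i : ℕ)) : ZMod ((F.P K).sitesPerDir 0)))
            (fun k => ((((a.src k).val * F.L ^ j : ℕ)) : ZMod ((F.P K).sitesPerDir 0))) + 64 * F.L ^ i ≤ 64 * F.L ^ j).card
      ≤ (Finset.univ.filter fun q : Plaq (F.P K) i => Site.tdist s q.src ≤ 64 * F.L ^ (j - i)).card :=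
        Finset.card_le_card hsub
    _ ≤ (ball s (64 * F.L ^ (j - i)) ×ˢ (Finset.univ : Finset (Fin (F.P K).d × Fin (F.P K).d))).card :=
        Finset.card_le_card_of_injOn f hmaps hinj
    _ = (ball s (64 * F.L ^ (j - i))).card * 9 := by
        rw [Finset.card_product, Finset.card_univ, Fintype.card_prod, Fintype.card_fin, T3Family.P_d]
    _ ≤ (2 * (64 * F.L ^ (j - i)) + 1) ^ 3 * 9 := by
        have h := card_ball_le s (64 * F.L ^ (j - i))
        rw [T3Family.P_d] at h
        exact Nat.mul_le_mul_right 9 h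
    _ = 9 * (2 * (64 * F.L ^ (j - i)) + 1) ^ 3 := by ring

/-- The local count in real form: `≤ 9·129³·L^{3(j−i)}`. [cite: Balaban1985UV3, p.258] -/
theorem card_near_le_real (F : T3Family) {K i j : ℕ} (hij : i ≤ j) (hjK : j ≤ K) (a : Plaq (F.P K) j) :
    ((Finset.univ.filter fun q : Plaq (F.P K) i =>
        Site.tdist (fun k => ((((q.src k).val * F.L ^ i : ℕ)) : ZMod ((F.P K).sitesPerDir 0)))
            (fun k => ((((a.src k).val * F.L ^ j : ℕ)) : ZMod ((F.P K).sitesPerDir 0))) + 64 * F.L ^ i ≤ 64 * F.L ^ j).card : ℝ) ≤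
      9 * 129 ^ 3 * ((F.L : ℝ) ^ (j - i)) ^ 3 := by
  have h := card_near_le F hij hjK a
  have hcast : ((Finset.univ.filter fun q : Plaq (F.P K) i =>
        Site.tdist (fun k => ((((q.src k).val * F.L ^ i : ℕ)) : ZMod ((F.P K).sitesPerDir 0)))
            (fun k => ((((a.src k).val * F.L ^ j : ℕ)) : ZMod ((F.P K).sitesPerDir 0))) + 64 * F.L ^ i ≤ 64 * F.L ^ j).card : ℝ) ≤
      9 * (2 * (64 * (F.L : ℝ) ^ (j - i)) + 1) ^ 3 := by exact_mod_cast h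
  refine hcast.trans ?_
  have hL1 : (1 : ℝ) ≤ (F.L : ℝ) ^ (j - i) := one_le_pow₀ (by exact_mod_cast F.hL.2.le)
  have hle : 2 * (64 * (F.L : ℝ) ^ (j - i)) + 1 ≤ 129 * (F.L : ℝ) ^ (j - i) := by linarith
  have h0 : 0 ≤ 2 * (64 * (F.L : ℝ) ^ (j - i)) + 1 := by positivity
  calc 9 * (2 * (64 * (F.L : ℝ) ^ (j - i)) + 1) ^ 3 ≤ 9 * (129 * (F.L : ℝ) ^ (j - i)) ^ 3 := by gcongr
    _ = 9 * 129 ^ 3 * ((F.L : ℝ) ^ (j - i)) ^ 3 := by ring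

/-! ## §3 The finest-bad-level covering of the complement of a local good set -/

/-- **FINEST BAD LEVEL.**  For any observables `f i q` (indexed by level `i` and plaquette `q` of `T^{(i)}` of the `K`-th approximation)
and thresholds `θ i`: a configuration outside the local good set
`G(a,j) = {U | ∀ i < j, ∀ q near a, f i q U < θ i}` (`near`: finest corners within `64L^j − 64L^i`) has a finest bad level `i < j` with a bad
plaquette `q` near `a`, and lies in `G(q,i)` — nearness to `q` at levels `i' < i` implies nearness to `a` (`tdist` triangle inequality:
`(64L^i − 64L^{i'}) + (64L^j − 64L^i) = 64L^j − 64L^{i'}`).  Hence `G(a,j)ᶜ ⊆ ⋃_{i<j} ⋃_{q near a} ({θ i ≤ f i q} ∩ G(q,i))`. [folklore] -/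
theorem compl_localGood_subset (F : T3Family) {X : Type*} (K j : ℕ) (a : Plaq (F.P K) j)
    (f : (i : ℕ) → Plaq (F.P K) i → X → ℝ) (θ : ℕ → ℝ) :
    {U : X | ∀ (i : ℕ) (q : Plaq (F.P K) i), i < j →
        Site.tdist (fun k => ((((q.src k).val * F.L ^ i : ℕ)) : ZMod ((F.P K).sitesPerDir 0)))
            (fun k => ((((a.src k).val * F.L ^ j : ℕ)) : ZMod ((F.P K).sitesPerDir 0))) + 64 * F.L ^ i ≤ 64 * F.L ^ j →
        f i q U < θ i}ᶜ ⊆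
      ⋃ i ∈ Finset.range j, ⋃ q ∈ (Finset.univ.filter fun q : Plaq (F.P K) i =>
          Site.tdist (fun k => ((((q.src k).val * F.L ^ i : ℕ)) : ZMod ((F.P K).sitesPerDir 0)))
            (fun k => ((((a.src k).val * F.L ^ j : ℕ)) : ZMod ((F.P K).sitesPerDir 0))) + 64 * F.L ^ i ≤ 64 * F.L ^ j),
        ({U : X | θ i ≤ f i q U} ∩
          {U : X | ∀ (i' : ℕ) (q' : Plaq (F.P K) i'), i' < i →
            Site.tdist (fun k => ((((q'.src k).val * F.L ^ i' : ℕ)) : ZMod ((F.P K).sitesPerDir 0)))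
                (fun k => ((((q.src k).val * F.L ^ i : ℕ)) : ZMod ((F.P K).sitesPerDir 0))) + 64 * F.L ^ i' ≤ 64 * F.L ^ i →
            f i' q' U < θ i'}) := by
  classical
  intro U hU
  simp only [Set.mem_compl_iff, Set.mem_setOf_eq, not_forall, not_lt, exists_prop] at hU
  -- the set of bad levels is nonempty; take the least one
  let bad : ℕ → Prop := fun i => ∃ q : Plaq (F.P K) i, i < j ∧
    Site.tdist (fun k => ((((q.src k).val * F.L ^ i : ℕ)) : ZMod ((F.P K).sitesPerDir 0)))
        (fun k => ((((a.src k).val * F.L ^ j : ℕ)) : ZMod ((F.P K).sitesPerDir 0))) + 64 * F.L ^ i ≤ 64 * F.L ^ j ∧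
      θ i ≤ f i q U
  have hex : ∃ i, bad i := by
    obtain ⟨i, q, hi, hnear, hle⟩ := hU
    exact ⟨i, q, hi, hnear, hle⟩
  set i₀ := Nat.find hex with hi₀
  obtain ⟨q₀, hi₀j, hnear₀, hle₀⟩ : bad i₀ := Nat.find_spec hex
  have hmin : ∀ i', i' < i₀ → ¬ bad i' := fun i' hi' => Nat.find_min hex hi'
  simp only [Set.mem_iUnion, Set.mem_inter_iff, Set.mem_setOf_eq, Finset.mem_range, Finset.mem_filter, Finset.mem_univ,
    true_and, exists_prop]
  refine ⟨i₀, hi₀j, q₀, hnear₀, hle₀, fun i' q' hi' hnear' => ?_⟩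
  -- nearness to `q₀` at level `i' < i₀` gives nearness to `a`
  have hnear'' : Site.tdist (fun k => ((((q'.src k).val * F.L ^ i' : ℕ)) : ZMod ((F.P K).sitesPerDir 0)))
      (fun k => ((((a.src k).val * F.L ^ j : ℕ)) : ZMod ((F.P K).sitesPerDir 0))) + 64 * F.L ^ i' ≤ 64 * F.L ^ j := by
    have htri := tdist_triangle (fun k => ((((q'.src k).val * F.L ^ i' : ℕ)) : ZMod ((F.P K).sitesPerDir 0)))
      (fun k => ((((q₀.src k).val * F.L ^ i₀ : ℕ)) : ZMod ((F.P K).sitesPerDir 0)))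
      (fun k => ((((a.src k).val * F.L ^ j : ℕ)) : ZMod ((F.P K).sitesPerDir 0)))
    omega
  by_contra hge
  rw [not_lt] at hge
  exact hmin i' hi' ⟨q', hi'.trans hi₀j, hnear'', hge⟩

end Summit.QuantumFields.YangMills.Theorems.PoincareLipschitz.TwoSidedOfConcentration
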